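/-
Copyright (c) 2026 The HCML crux team. All rights reserved.
Released under Apache 2.0 license as described in the file LICENSE.
Authors: K2E5-p17 (g4) (explicit-unit `hodgecm-mathlib-K2E5-p17-g4`)
-/
import Summits.HodgeConjecture.HodgeConjecture.Theorems.K2E3GLnCuspFormCancellationInputs   -- ★ (B-val) part 1 (this seat): the `exp`-dictionary, `ne_zero_of_coe_eq_diagonal` via ★ V0
import Mathlib.Data.Fin.Tuple.Sort
import HarnessLib

/-!
# K2_E3 road (h413), U12 «Characters» — Theorem 20 for `GL₃(F)`, FILE (B-val) part 2: the COVERS «chamber × regime» of the split torus `A` and the two directions of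
# the rank-one torus `{diag(λ, λ, μ)}` (the `hcover` inputs of ★ (A)∕(A′))

Cell `pub/hodgecm-mathlib` (D-0151), Track B, seat K2E5-p17 (g4); line lead K2E3-p23 (g5) (RULINGS #12 (M12-3), (M12-5)), co-owner K2E3-p21 (g5), dealer K2E3-plan (g3).
`--supports stmt-HodgeConjecture-24833 --as helper`; THEOREMS ONLY (no definition ∕ instance ∕ notation ∕ named fact ∕ `sorry`); never imports `Cruxes/…/Lines`.  COUNT-NEUTRAL.
Consumer: FILE (C) `K2E3GL3CuspFormCancellation`.

THE MATHEMATICS [HarishChandra1970, VII §8 p. 80: `A` is covered by the `W`-translates of the cones `A_F^+(t)`].  Write `|d_i| = q^{x_i}` for a diagonal `a = diag(d) ∈ GL₃(F)`;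
`a ∉ 𝔅_R` means `x_i − x_j > R` for some `i, j`.  Put `E := j₀ + 4 m_C` (the depth from which ★ (A) must contract) and `R := 6E`.  Ordering `x ∘ σ` decreasingly
(`σ ∈ S₃`, the chamber), the simple-root sizes `e₁ = x_{σ0} − x_{σ1}`, `e₂ = x_{σ1} − x_{σ2}` are `≥ 0` with `e₁ + e₂ ≥ 6E + 1`, so exactly one of three REGIMES occurs:
BOREL (`e₁, e₂ ≥ E+1`: `a⁻¹` contracts the whole `σ N_B σ⁻¹` from depth `E+1`, no Levi defect), `(1,2)` (`e₂ ≤ E`, hence `e₁ ≥ 5E+1`: `a⁻¹` contracts `σ N_{(1,2)} σ⁻¹` from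
depth `5E+1` and `a` is `E`-bounded on the Levi `GL₁ × GL₂`), `(2,1)` (symmetric).  The regimes are written with the label functions `id : Fin 3 → Fin 3`, `![0,1,1]`, `![0,0,1] : Fin 3 → Fin 2` (★ (B-Iw)'s two-block currency)
in the generic «piece» binders of part 1 (`|d_i⁻¹ d_j| ≤ |ϖ^h|` for `c i < c j`, `|ϖ^E d_i d_j⁻¹| ≤ 1` for `c i = c j`).  For the rank-one torus `{diag(λ,λ,μ)}` (the split
part of the mixed Cartan `T_E ⊂ M_{(2,1)}`, (M12-5)) no chambers are needed: the two directions `![0,0,1]`, `![1,1,0]` with defect `0`.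
* `exists_perm_sorted`, **`cover_exponents`** (ℤ-form), `regime_of_exponents`, **`cover_of_not_adBall`** (`t = diag d ∉ 𝔅_R`, `6E ≤ R`), **`cover_blockScalar_of_not_adBall`**.

HONEST LABEL: HC_CM is proved only modulo the 7 printed citations (2 remaining named inputs: hLiu418 = stmt-HodgeConjecture-24832, h413 = stmt-HodgeConjecture-24833)
until rung 0 closes; count-neutral helper (integer bookkeeping; nothing printed is asserted).

## References
* [HarishChandra1970] Harish-Chandra (notes by G. van Dijk), *Harmonic Analysis on Reductive p-adic Groups*, LNM 162 (1970), Part VII §8 p. 80 (`A_F^+(t)`, `s ∈ W`).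
* [Casselman1995] W. Casselman, *Introduction to the theory of admissible representations of p-adic reductive groups* (1995), Prop. 1.4.3.
-/

set_option autoImplicit false
set_option linter.dupNamespace false   -- `Summit.HodgeConjecture.HodgeConjecture.…` (D-0017 nested layout; lakefile exemption for Summits)

noncomputable section

open scoped MatrixGroups WithZero
open Matrix
open Summit.HodgeConjecture.HodgeConjecture.Cruxes.H413.K2E3GLnAdHeightBalls
open Summit.HodgeConjecture.HodgeConjecture.Cruxes.H413.K2E3GLnUnipotentAdHeight
open Summit.HodgeConjecture.HodgeConjecture.Cruxes.H413.K2E3GLnCuspFormCancellationInputs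

namespace Summit.HodgeConjecture.HodgeConjecture.Cruxes.H413.K2E3GL3CuspFormCancellationCover

section Cover

/-- Sorting three integers: some permutation lists them in decreasing order. [folklore] -/
theorem exists_perm_sorted (x : Fin 3 → ℤ) : ∃ σ : Equiv.Perm (Fin 3), x (σ 1) ≤ x (σ 0) ∧ x (σ 2) ≤ x (σ 1) := by
  have hmono := Tuple.monotone_sort x
  refine ⟨Fin.revPerm.trans (Tuple.sort x), ?_, ?_⟩
  · have h := hmono (show (1 : Fin 3) ≤ 2 by decide)
    simpa [Equiv.trans_apply] using h
  · have h := hmono (show (0 : Fin 3) ≤ 1 by decide)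
    simpa [Equiv.trans_apply] using h

/-- **THE COVER, EXPONENT FORM.**  If the valuation exponents `x : Fin 3 → ℤ` of a diagonal element satisfy `x_i − x_j > 6E` for some `i, j` (the element is outside
`𝔅_{6E}`), then in some chamber `σ` (ordering `x ∘ σ` decreasingly) one of three regimes holds: BOREL — both simple roots `≥ E+1`; `(1,2)` — `x_{σ0}` exceeds the other
two by `≥ 5E+1` and these differ by `≤ E`; `(2,1)` — `x_{σ2}` is below the other two by `≥ 5E+1` and these differ by `≤ E` (`e₁ + e₂ ≥ 6E+1`, `e₁, e₂ ≥ 0`: if both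
`≥ E+1` Borel, else the small one is `≤ E` and the other `≥ 5E+1`).  Written with the label functions `id : Fin 3 → Fin 3` and `![0,1,1]`, `![0,0,1] : Fin 3 → Fin 2` of FILE (C) (★ (B-Iw)'s two-block currency).
[cite: HarishChandra1970, Part VII §8 p. 80 (`A_F^+(t)`)] [cite: Casselman1995, Prop. 1.4.3] -/
theorem cover_exponents {x : Fin 3 → ℤ} {E : ℕ} (hfar : ∃ i j, (6 * E : ℤ) < x i - x j) :
    ∃ σ : Equiv.Perm (Fin 3),
      ((∀ i j : Fin 3, (id : Fin 3 → Fin 3) i < (id : Fin 3 → Fin 3) j → x (σ j) + ((E + 1 : ℕ) : ℤ) ≤ x (σ i)) ∧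
        ∀ i j : Fin 3, (id : Fin 3 → Fin 3) i = (id : Fin 3 → Fin 3) j → x (σ i) ≤ x (σ j) + ((0 : ℕ) : ℤ)) ∨
      ((∀ i j : Fin 3, (![0, 1, 1] : Fin 3 → Fin 2) i < (![0, 1, 1] : Fin 3 → Fin 2) j → x (σ j) + ((5 * E + 1 : ℕ) : ℤ) ≤ x (σ i)) ∧
        ∀ i j : Fin 3, (![0, 1, 1] : Fin 3 → Fin 2) i = (![0, 1, 1] : Fin 3 → Fin 2) j → x (σ i) ≤ x (σ j) + ((E : ℕ) : ℤ)) ∨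
      ((∀ i j : Fin 3, (![0, 0, 1] : Fin 3 → Fin 2) i < (![0, 0, 1] : Fin 3 → Fin 2) j → x (σ j) + ((5 * E + 1 : ℕ) : ℤ) ≤ x (σ i)) ∧
        ∀ i j : Fin 3, (![0, 0, 1] : Fin 3 → Fin 2) i = (![0, 0, 1] : Fin 3 → Fin 2) j → x (σ i) ≤ x (σ j) + ((E : ℕ) : ℤ)) := by
  obtain ⟨σ, h10, h21⟩ := exists_perm_sorted x
  obtain ⟨i₀, j₀, hfar⟩ := hfar
  -- the extreme gap dominates every gap
  have hmax : ∀ i, x i ≤ x (σ 0) := by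
    intro i
    obtain ⟨k, rfl⟩ := σ.surjective i
    fin_cases k <;> simp <;> omega
  have hmin : ∀ j, x (σ 2) ≤ x j := by
    intro j
    obtain ⟨k, rfl⟩ := σ.surjective j
    fin_cases k <;> simp <;> omega
  have hgap : (6 * E : ℤ) < x (σ 0) - x (σ 2) := lt_of_lt_of_le hfar (by linarith [hmax i₀, hmin j₀])
  refine ⟨σ, ?_⟩
  by_cases hB : x (σ 1) + (E + 1 : ℤ) ≤ x (σ 0) ∧ x (σ 2) + (E + 1 : ℤ) ≤ x (σ 1)
  · refine Or.inl ⟨fun i j hij => ?_, fun i j hij => ?_⟩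
    · fin_cases i <;> fin_cases j <;> simp at hij ⊢ <;> omega
    · simp only [id_eq] at hij; subst hij; push_cast; omega
  by_cases h2 : x (σ 1) ≤ x (σ 2) + (E : ℤ)
  · -- regime `(1,2)`: the small root is `e₂`
    refine Or.inr (Or.inl ⟨fun i j hij => ?_, fun i j hij => ?_⟩)
    · fin_cases i <;> fin_cases j <;> simp at hij ⊢ <;> omega
    · fin_cases i <;> fin_cases j <;> simp at hij ⊢ <;> omega
  · -- regime `(2,1)`: the small root is `e₁`
    refine Or.inr (Or.inr ⟨fun i j hij => ?_, fun i j hij => ?_⟩)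
    · fin_cases i <;> fin_cases j <;> simp at hij ⊢ <;> omega
    · fin_cases i <;> fin_cases j <;> simp at hij ⊢ <;> omega

variable {F : Type*} [Field F] [Valued F ℤᵐ⁰] {ϖ : F} (hϖ : Valued.v ϖ = WithZero.exp (-1 : ℤ))

include hϖ in
/-- Translating a regime from exponents to valuations (one label function `c`, thresholds `h`, `E`). [cite: HarishChandra1970, Part VII §8 p. 80] -/
theorem regime_of_exponents {β : Type*} [LinearOrder β] {d : Fin 3 → F} {x : Fin 3 → ℤ} (hx : ∀ i, Valued.v (d i) = WithZero.exp (x i))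
    (σ : Equiv.Perm (Fin 3)) (c : Fin 3 → β)
    {h E : ℕ} (h1 : ∀ i j : Fin 3, c i < c j → x (σ j) + (h : ℤ) ≤ x (σ i)) (h2 : ∀ i j : Fin 3, c i = c j → x (σ i) ≤ x (σ j) + (E : ℤ)) :
    (∀ i j : Fin 3, c i < c j → Valued.v ((d (σ i))⁻¹ * d (σ j)) ≤ Valued.v (ϖ ^ h)) ∧
      ∀ i j : Fin 3, c i = c j → Valued.v (ϖ ^ E * (d (σ i) * (d (σ j))⁻¹)) ≤ 1 := by
  have hx' : ∀ i, Valued.v ((d ∘ σ) i) = WithZero.exp ((x ∘ σ) i) := fun i => hx (σ i)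
  exact ⟨fun i j hij => (v_inv_mul_le_iff hϖ hx' i j h).2 (h1 i j hij), fun i j hij => (v_pow_mul_div_le_one_iff hϖ hx' i j E).2 (h2 i j hij)⟩

include hϖ in
/-- **THE COVER OF THE SPLIT TORUS OF `GL₃`** (the `hcover` input of ★ (A′) for `Γ = A`): for `t = diag(d)` outside `𝔅_R` with `6E ≤ R` there are a chamber
`σ ∈ S₃` and a regime — BOREL (`c = id`, depth `E+1`, defect `0`), `(1,2)` (`c = ![0,1,1]`, depth `5E+1`, defect `E`) or `(2,1)` (`c = ![0,0,1]`, depth `5E+1`,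
defect `E`) — such that `d ∘ σ` lies in the corresponding piece: `|d_{σi}⁻¹ d_{σj}| ≤ |ϖ^{depth}|` for `c i < c j` and `|ϖ^{defect} d_{σi} d_{σj}⁻¹| ≤ 1` for `c i = c j`.
[cite: HarishChandra1970, Part VII §8 p. 80 (`A = ⋃_s A^+(t)^s`)] [cite: Casselman1995, Prop. 1.4.3] -/
theorem cover_of_not_adBall {t : GL (Fin 3) F} {d : Fin 3 → F} (ht : (t : Matrix (Fin 3) (Fin 3) F) = Matrix.diagonal d) {E R : ℕ} (hR : 6 * E ≤ R)
    (hfar : ¬ ∀ i j k l, Valued.v (ϖ ^ R * ((t : Matrix (Fin 3) (Fin 3) F) i j * ((t⁻¹ : GL (Fin 3) F) : Matrix (Fin 3) (Fin 3) F) k l)) ≤ 1) :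
    ∃ σ : Equiv.Perm (Fin 3),
      ((∀ i j : Fin 3, (id : Fin 3 → Fin 3) i < (id : Fin 3 → Fin 3) j → Valued.v ((d (σ i))⁻¹ * d (σ j)) ≤ Valued.v (ϖ ^ (E + 1))) ∧
        ∀ i j : Fin 3, (id : Fin 3 → Fin 3) i = (id : Fin 3 → Fin 3) j → Valued.v (ϖ ^ 0 * (d (σ i) * (d (σ j))⁻¹)) ≤ 1) ∨
      ((∀ i j : Fin 3, (![0, 1, 1] : Fin 3 → Fin 2) i < (![0, 1, 1] : Fin 3 → Fin 2) j → Valued.v ((d (σ i))⁻¹ * d (σ j)) ≤ Valued.v (ϖ ^ (5 * E + 1))) ∧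
        ∀ i j : Fin 3, (![0, 1, 1] : Fin 3 → Fin 2) i = (![0, 1, 1] : Fin 3 → Fin 2) j → Valued.v (ϖ ^ E * (d (σ i) * (d (σ j))⁻¹)) ≤ 1) ∨
      ((∀ i j : Fin 3, (![0, 0, 1] : Fin 3 → Fin 2) i < (![0, 0, 1] : Fin 3 → Fin 2) j → Valued.v ((d (σ i))⁻¹ * d (σ j)) ≤ Valued.v (ϖ ^ (5 * E + 1))) ∧
        ∀ i j : Fin 3, (![0, 0, 1] : Fin 3 → Fin 2) i = (![0, 0, 1] : Fin 3 → Fin 2) j → Valued.v (ϖ ^ E * (d (σ i) * (d (σ j))⁻¹)) ≤ 1) := by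
  obtain ⟨x, hx⟩ := exists_v_eq_exp d (ne_zero_of_coe_eq_diagonal ht)
  -- outside `𝔅_R`: some `|ϖ^R d_i/d_j| > 1`, i.e. `x_i − x_j > R ≥ 6E`
  rw [adBall_iff_of_coe_eq_diagonal ϖ R ht] at hfar
  push Not at hfar
  obtain ⟨i, j, hij⟩ := hfar
  have hfar' : ∃ i j, (6 * E : ℤ) < x i - x j := by
    refine ⟨i, j, ?_⟩
    have h := (not_congr (v_pow_mul_div_le_one_iff hϖ hx i j R)).1 (not_le.2 hij)
    omega
  obtain ⟨σ, hσ⟩ := cover_exponents (E := E) hfar'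
  refine ⟨σ, ?_⟩
  rcases hσ with ⟨h1, h2⟩ | ⟨h1, h2⟩ | ⟨h1, h2⟩
  · exact Or.inl (regime_of_exponents hϖ hx σ _ h1 h2)
  · exact Or.inr (Or.inl (regime_of_exponents hϖ hx σ _ h1 h2))
  · exact Or.inr (Or.inr (regime_of_exponents hϖ hx σ _ h1 h2))

include hϖ in
/-- **THE COVER OF THE RANK-ONE TORUS `{diag(λ, λ, μ)}`** (the `hcover` input for `Γ = T_E ⊂ M_{(2,1)}`, (M12-5)): for `t = diag(d)` with `d₀ = d₁` outside `𝔅_R`,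
EITHER `|d_i⁻¹ d_2| ≤ |ϖ^{R+1}|` for `i = 0, 1` (direction `c = ![0,0,1]`: `a⁻¹` contracts `N_{(2,1)}`) OR `|d_2⁻¹ d_j| ≤ |ϖ^{R+1}|` for `j = 0, 1` (direction
`c = ![1,1,0]`: `a⁻¹` contracts `N̄_{(2,1)}`); in both cases the Levi defect is `0` (`a` is central in `M_{(2,1)}`).  No chambers are needed.
[cite: HarishChandra1970, Part VII §8 p. 80 (`A = A⁺ ∪ A⁻` in rank one)] [cite: Casselman1995, Prop. 1.4.3] -/
theorem cover_blockScalar_of_not_adBall {t : GL (Fin 3) F} {d : Fin 3 → F} (ht : (t : Matrix (Fin 3) (Fin 3) F) = Matrix.diagonal d) (h01 : d 0 = d 1) {R : ℕ}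
    (hfar : ¬ ∀ i j k l, Valued.v (ϖ ^ R * ((t : Matrix (Fin 3) (Fin 3) F) i j * ((t⁻¹ : GL (Fin 3) F) : Matrix (Fin 3) (Fin 3) F) k l)) ≤ 1) :
    ((∀ i j : Fin 3, (![0, 0, 1] : Fin 3 → Fin 2) i < (![0, 0, 1] : Fin 3 → Fin 2) j → Valued.v ((d i)⁻¹ * d j) ≤ Valued.v (ϖ ^ (R + 1))) ∧
        ∀ i j : Fin 3, (![0, 0, 1] : Fin 3 → Fin 2) i = (![0, 0, 1] : Fin 3 → Fin 2) j → Valued.v (ϖ ^ 0 * (d i * (d j)⁻¹)) ≤ 1) ∨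
      ((∀ i j : Fin 3, (![1, 1, 0] : Fin 3 → Fin 2) i < (![1, 1, 0] : Fin 3 → Fin 2) j → Valued.v ((d i)⁻¹ * d j) ≤ Valued.v (ϖ ^ (R + 1))) ∧
        ∀ i j : Fin 3, (![1, 1, 0] : Fin 3 → Fin 2) i = (![1, 1, 0] : Fin 3 → Fin 2) j → Valued.v (ϖ ^ 0 * (d i * (d j)⁻¹)) ≤ 1) := by
  obtain ⟨x, hx⟩ := exists_v_eq_exp d (ne_zero_of_coe_eq_diagonal ht)
  have hx01 : x 0 = x 1 := by
    have h := hx 0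
    rw [h01, hx 1] at h
    exact (WithZero.exp_injective h).symm
  rw [adBall_iff_of_coe_eq_diagonal ϖ R ht] at hfar
  push Not at hfar
  obtain ⟨i, j, hij⟩ := hfar
  have hgap : (R : ℤ) < x i - x j := by
    have h := (not_congr (v_pow_mul_div_le_one_iff hϖ hx i j R)).1 (not_le.2 hij)
    omega
  have hx1 : ∀ i, Valued.v ((d ∘ (1 : Equiv.Perm (Fin 3))) i) = WithZero.exp ((x ∘ (1 : Equiv.Perm (Fin 3))) i) := fun i => hx i
  -- either `x₂` is far below `x₀ = x₁`, or far above
  by_cases hcase : x 2 + (R + 1 : ℤ) ≤ x 0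
  · refine Or.inl ⟨fun a b hab => (v_inv_mul_le_iff hϖ hx a b (R + 1)).2 ?_, fun a b hab => (v_pow_mul_div_le_one_iff hϖ hx a b 0).2 ?_⟩
    · fin_cases a <;> fin_cases b <;> simp at hab ⊢ <;> omega
    · fin_cases a <;> fin_cases b <;> simp at hab ⊢ <;> omega
  · have hcase' : x 0 + (R + 1 : ℤ) ≤ x 2 := by
      fin_cases i <;> fin_cases j <;> simp at hgap <;> omega
    refine Or.inr ⟨fun a b hab => (v_inv_mul_le_iff hϖ hx a b (R + 1)).2 ?_, fun a b hab => (v_pow_mul_div_le_one_iff hϖ hx a b 0).2 ?_⟩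
    · fin_cases a <;> fin_cases b <;> simp at hab ⊢ <;> omega
    · fin_cases a <;> fin_cases b <;> simp at hab ⊢ <;> omega

end Cover

end Summit.HodgeConjecture.HodgeConjecture.Cruxes.H413.K2E3GL3CuspFormCancellationCover

end
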